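import Summits.ResolutionOfSingularities.ResolutionOfSingularities.Theorems.FrobeniusClosingSteerFarPthPowerNearReduction
import Summits.ResolutionOfSingularities.ResolutionOfSingularities.Theorems.FrobeniusClosingSteerHullVocabulary
import HarnessLib

/-!
# Crux `Steer` (stmt-ResolutionOfSingularities-16345), line `switching_dichotomy`, NSCᴹ budget line (idea-2 card 3):
# U3 · `FarPthPowerNearReduction` over the HOISTED HULL VOCABULARY (res-type-028's U2 `…SteerHullVocabulary`)

OURS (campaign `res-hironaka`, rung L ★L-G4, slot W4.1, chain W4.1; seat `res-L0-w41-stub-4` g4; Theses-free, definition-free LEAF: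
idea-2's support Prop `Idea2g4.FarPthPowerNearReduction p` (Sketch-idea-2f 64403cb98dc5de30 l.868) with the repair of record
`t ^ p ∈ R 0` (res-L0-w41-plan-1 RULING 24a), stated over `Hull.IsPointSequenceAlong` / `Hull.shannonExt` / `Hull.IsHullParameter` /
`Hull.IsNear` / `Hull.GenAt` / `Hull.ToroidalAt` (p517308) and closed by the def-free `FarPthPowerNear.farPthPowerNearReduction_of_mem_zero`
(p517195); replaces the role of no printed item; NOT a statement of the manuscript under review [claim: Hironaka2017, status: under-review];
AI-produced, which is weaker than expert review). [cite: HeinzerEtAl2015, Prop. 4.4, Lemma 2.7] [folklore]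
-/

-- `Summit.<S>.<S>.…` duplicates the summit name by design (single-problem summit).
set_option linter.dupNamespace false

open IsLocalRing
open Literature.AlgebraicGeometry.Resolution

namespace Summit.ResolutionOfSingularities.ResolutionOfSingularities.Theorems.SwitchingDichotomy

namespace FarPthPowerNear

variable {k K : Type} [Field k] [Field K] [Algebra k K]

/-- **U3 over the hoisted hull vocabulary** (= idea-2's `FarPthPowerNearReduction p`, Sketch-idea-2f l.868, binders VERBATIM, plus
the repair of record `t ^ p ∈ R 0`): if the radicand is a `p`-th power × NEAR × (hull parameter)`^j` then WITHOUT any blow-up some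
member carries a generator (`Hull.GenAt`) whose radicand is toroidal (`Hull.ToroidalAt`) or a unit.
[cite: HeinzerEtAl2015, Prop. 4.4, Lemma 2.7] [folklore] -/
theorem farPthPowerNearReduction_hull (p : ℕ) (k K : Type) [Field k] [Field K] [Algebra k K]
    (O : ValuationSubring K) (A₀ : Subalgebra k K) (h₀ : A₀.toSubring ≤ O.toSubring) (R : ℕ → Subring K)
    (x t m u : K) (j : ℤ) (_hfg : A₀.FG)
    (hreg : IsRegularLocalRing (Localization.AtPrime
      (Ideal.comap (Subring.inclusion h₀) (IsLocalRing.maximalIdeal O))))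
    (hR : Hull.IsPointSequenceAlong O A₀ R) (hx : Hull.IsHullParameter O R x) (_hRO : ∀ i, R i ≤ O.toSubring)
    (hm : m ∈ Hull.shannonExt R) (hu : Hull.IsNear R x u) (ht : t ^ p ∈ R 0)
    (h : t ^ p = m ^ p * u * x ^ j) :
    ∃ (i : ℕ) (_ : IsLocalRing (R i)) (s' : K), Hull.GenAt (R i) p t s' ∧
      (Hull.ToroidalAt p (R i) (s' ^ p) ∨ ∃ w : R i, IsUnit w ∧ s' ^ p = (w : K)) := by
  obtain ⟨i, hloc, s', hgen, hrad⟩ :=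
    farPthPowerNearReduction_of_mem_zero p O A₀ h₀ R x t m u j hreg hR.1 hR.2 hx.1 hm hu.1 hu.2.2 ht h
  exact ⟨i, hloc, s', hgen, hrad⟩

end FarPthPowerNear

end Summit.ResolutionOfSingularities.ResolutionOfSingularities.Theorems.SwitchingDichotomy
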